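import Mathlib
import HarnessLib
import Literature.ModelTheory.FiniteModelTheory.CFIUncolouredProofs
import Literature.ModelTheory.FiniteModelTheory.CkEquivTransfer
import Literature.Combinatorics.SimpleGraph.TreewidthBrambleLowerBound

/-!
# Route MonotoneRestoration, crux `MonotoneRestorationQP` (stmt-15886), line `linear_width` —
# ROBERSON-TYPE MONOTONICITY OF HOMOMORPHISM COUNTS INTO THE TREE'S CFI GRAPHS, AND LINEAR-SIZE
# `C^k`-WITNESSES FOR EVERY PATTERN THAT RETRACTS ONTO A 2-SUBDIVIDED BASE OF LARGE TREE-WIDTH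

Helper file (`--supports stmt-ValiantsHypothesis-15886`), def-free.

The conditional rungs of the line (`SmallWitnessRung.qpOrbitSymm_of_smallWitness`, p840965; `SqrtRung`, p841022;
`IsolationAnyLevel.qpOrbit_of_matrixSymmetric_of_smallDistinguishable`, p840908) consume ONE input that is not a tree
theorem: SMALL WITNESSES — for a wide bipartite pattern `F`, two `C^k`-equivalent hosts of size polynomial (there: in
`k`; what the isolation lemma really needs: `≤ N / deg f_N`, so size LINEAR IN THE PATTERN suffices for the `√N` rung)
with different numbers of homomorphisms from `F`.  The tree PROVES the Cai–Fürer–Immerman machinery of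
Chen–Flum–Liu 2025 (`ChenFlumLiu2025_ckEquiv_of_le_treewidth_holds`: `tw G ≥ k ⇒ CFI(G,∅) ≡_{C^k} CFI(G,{e})`;
`ChenFlumLiu2025.card_hom_subdiv_lt`: the 2-subdivision `G₂` has FEWER homomorphisms into the twisted graph), but the
hom-count gap is available for the single pattern `G₂` only.  This file records the general form:

* `isHom_dsub_of_isHom` — Chen–Flum–Liu's difference map (`dsub`, Lemma 12.5) turns two lifts `F → CFI(G,T)` with the
  same shadow in `G₂` into a lift `F → CFI(G,∅)`, for an ARBITRARY source graph `F` (the tree states it for `F = G₂`);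
* `exists_injective_projPreserving` — an injection `Hom(F, CFI(G,T)) ↪ Hom(F, CFI(G,∅))` preserving shadows;
* `card_hom_cfiGraph_le` — **MONOTONICITY** (Roberson 2022, Thm 3.6, in the tree's CFI model): for EVERY finite graph
  `F` and every twist set `T`, `hom(F, CFI(G,T)) ≤ hom(F, CFI(G,∅))`;
* `card_hom_cfiGraph_lt_of_retract` — **STRICTNESS**: if the 2-subdivision `G₂` is a RETRACT of `F` (homomorphisms
  `ι : G₂ → F`, `ρ : F → G₂`, `ρ ∘ ι = id`) and `e` is an edge of `G`, then `hom(F, CFI(G,{e})) < hom(F, CFI(G,∅))`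
  (the zero section over `ρ` is a homomorphism into the untwisted graph whose shadow no lift into the twisted graph has,
  by `not_isHom_of_proj_eq` pulled back along `ι`); `F = G₂` is Chen–Flum–Liu's Thm 12.2;
* `ckEquiv_and_card_hom_lt_of_retract`, `exists_fin_witness_of_retract` — **UNCONDITIONAL LINEAR-SIZE WITNESSES**: for
  `G` connected on `≥ 2` vertices with `tw G ≥ k ≥ 1` and every `F` retracting onto `G₂`, the CFI pair over `G` is
  `C^k`-equivalent and distinguished by `hom(F, ·)`; transported to hosts on `Fin m`, `m = |CFI(G)|`;
* `card_cfiVertex_le` — `|CFI(G)| ≤ v·2^Δ + 2·v·Δ` (`Δ` the maximum degree): LINEAR in `v` for bases of bounded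
  degree (grids, walls: `Δ ≤ 4`, tree `min_le_treewidth_grid`).

Placement (honest label).  This is the apex-free core of the "absorbing CFI pair" route to the `√N` rung WITHOUT the
not-in-print hypothesis (W1)_poly: what is still missing is (a) `C^k`-equivalence of the CFI pair with two apices
joined to the colour classes (colour-preserving Duplicator), (b) the same monotonicity/strictness for the apexed hosts
(then "retract" weakens to "contains an induced copy of `G₂`"), (c) a bounded-degree high-tree-width `B` with an
induced `B₂` inside every sparse wide pattern (excluded grid theorem, by name) — and dense wide patterns (`K_{d,d}`) have
no induced `B₂` at all, so they need a different witness family.  No stub closed; the rung `θ₁`, the cruxes and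
VP ≠ VNP are NOT moved.
[cite: ChenFlumLiu2025, Lemma 12.5, Thm 12.2, Thm 11.1; Roberson2022, Thm 3.6; CaiFurerImmerman1992, §6]
-/

set_option linter.dupNamespace false

noncomputable section

open scoped Classical

namespace Summit.ValiantsHypothesis.ValiantsHypothesis.Theorems.CFIHomMonotone

open Literature.ModelTheory.FiniteModelTheory Literature.ModelTheory.FiniteModelTheory.ChenFlumLiu2025

variable {v : ℕ} {G : SimpleGraph (Fin v)} [DecidableRel G.Adj]
variable {W : Type*} (F : SimpleGraph W)

/-! ### The difference of two lifts with a common shadow, for an arbitrary source graph -/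

/-- **Differences of two lifts over the same shadow are lifts to the untwisted graph** — Chen–Flum–Liu's Lemma 12.5
for an ARBITRARY source graph `F`: if `f, f₁ : F → CFI(G,T)` are homomorphisms with `p ∘ f₁ = p ∘ f` (`p` the projection
to `G₂`), then `x ↦ f x − f₁ x` (`dsub`) is a homomorphism `F → CFI(G,∅)`. [cite: ChenFlumLiu2025, Lemma 12.5] -/
theorem isHom_dsub_of_isHom {T : Set (Sym2 (Fin v))} [DecidablePred (· ∈ T)]
    {f f₁ : W → CFIVertex G} (hf : Dvorak2010.IsHom F (cfiGraph G T) f)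
    (hf₁ : Dvorak2010.IsHom F (cfiGraph G T) f₁) (hp : ∀ x, proj G (f₁ x) = proj G (f x)) :
    Dvorak2010.IsHom F (cfiEven G) (fun x => dsub (f x) (f₁ x)) :=
  fun a b hab => adj_dsub (hf hab) (hf₁ hab) (hp a) (hp b)

/-- **The fibrewise difference injection.**  There is an injective map from the homomorphisms `F → CFI(G,T)` to the
homomorphisms `F → CFI(G,∅)` preserving the shadow in `G₂`: subtract, fibre by fibre, a chosen element of the fibre
(`f ↦ f − f₀(p ∘ f)`).  This is the counting content of "`|Hom^T_g| ∈ {0, |Hom^∅_g|}`" (an affine system over `𝔽₂` and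
its homogeneous part). [cite: ChenFlumLiu2025, Lemma 12.5 and proof of Thm 12.2] -/
theorem exists_injective_projPreserving (T : Set (Sym2 (Fin v))) [DecidablePred (· ∈ T)] :
    ∃ Φ : {g : W → CFIVertex G // Dvorak2010.IsHom F (cfiGraph G T) g} →
        {g : W → CFIVertex G // Dvorak2010.IsHom F (cfiEven G) g},
      Function.Injective Φ ∧ ∀ f x, proj G ((Φ f).1 x) = proj G (f.1 x) := by
  classical
  -- a chosen element in the fibre of every realised shadow `g`
  let base : (g : W → Fin v ⊕ Dart G) →
      (∃ f₁ : {g : W → CFIVertex G // Dvorak2010.IsHom F (cfiGraph G T) g}, proj G ∘ f₁.1 = g) →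
      {g : W → CFIVertex G // Dvorak2010.IsHom F (cfiGraph G T) g} :=
    fun _ h => Classical.choose h
  have hbase : ∀ g (h : ∃ f₁ : {g : W → CFIVertex G // Dvorak2010.IsHom F (cfiGraph G T) g},
      proj G ∘ f₁.1 = g), proj G ∘ (base g h).1 = g :=
    fun g h => Classical.choose_spec h
  have hex : ∀ f : {g : W → CFIVertex G // Dvorak2010.IsHom F (cfiGraph G T) g},
      ∃ f₁ : {g : W → CFIVertex G // Dvorak2010.IsHom F (cfiGraph G T) g}, proj G ∘ f₁.1 = proj G ∘ f.1 :=
    fun f => ⟨f, rfl⟩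
  refine ⟨fun f => ⟨fun x => dsub (f.1 x) ((base _ (hex f)).1 x),
    isHom_dsub_of_isHom F f.2 (base _ (hex f)).2 fun x => congrFun (hbase _ (hex f)) x⟩, ?_, ?_⟩
  · intro f f' hff'
    have hval : ∀ x, dsub (f.1 x) ((base _ (hex f)).1 x) = dsub (f'.1 x) ((base _ (hex f')).1 x) :=
      fun x => congrFun (congrArg Subtype.val hff') x
    have hpf : proj G ∘ f.1 = proj G ∘ f'.1 := by
      funext x
      have := congrArg (proj G) (hval x)
      rwa [proj_dsub, proj_dsub] at this
    have hbb : base _ (hex f) = base _ (hex f') := by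
      have key : ∀ (g g' : W → Fin v ⊕ Dart G)
          (h : ∃ f₁ : {g : W → CFIVertex G // Dvorak2010.IsHom F (cfiGraph G T) g}, proj G ∘ f₁.1 = g)
          (h' : ∃ f₁ : {g : W → CFIVertex G // Dvorak2010.IsHom F (cfiGraph G T) g}, proj G ∘ f₁.1 = g'),
          g = g' → base g h = base g' h' := by
        intro g g' h h' hgg'
        subst hgg'
        rfl
      exact key _ _ _ _ hpf
    apply Subtype.ext
    funext x
    have h1 := hval x
    rw [hbb] at h1
    refine dsub_left_injective ?_ ?_ h1
    · have := congrFun (hbase _ (hex f')) x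
      simp only [Function.comp_apply] at this
      rw [this]
      exact congrFun hpf x
    · have := congrFun (hbase _ (hex f')) x
      simp only [Function.comp_apply] at this
      rw [this]
  · intro f x
    exact proj_dsub _ _

/-! ### Monotonicity and strictness -/

/-- **MONOTONICITY (Roberson-type, tree's CFI model).**  For every finite graph `F`, every base graph `G` and every twist
set `T`: `hom(F, CFI(G,T)) ≤ hom(F, CFI(G,∅))`.  (Roberson 2022 proves `hom(F, X₁(G)) ≤ hom(F, X₀(G))` for the compact
CFI graphs; the same `𝔽₂`-affine mechanism.) [cite: Roberson2022, Thm 3.6; ChenFlumLiu2025, Lemma 12.5] -/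
theorem card_hom_cfiGraph_le [Finite W] (T : Set (Sym2 (Fin v))) [DecidablePred (· ∈ T)] :
    Nat.card (F →g cfiGraph G T) ≤ Nat.card (F →g cfiEven G) := by
  classical
  rw [Dvorak2010.card_hom_eq_card_subtype, Dvorak2010.card_hom_eq_card_subtype]
  haveI := Fintype.ofFinite {g : W → CFIVertex G // Dvorak2010.IsHom F (cfiGraph G T) g}
  haveI := Fintype.ofFinite {g : W → CFIVertex G // Dvorak2010.IsHom F (cfiEven G) g}
  rw [Nat.card_eq_fintype_card, Nat.card_eq_fintype_card]
  obtain ⟨Φ, hΦ, -⟩ := exists_injective_projPreserving (G := G) F T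
  exact Fintype.card_le_of_injective Φ hΦ

/-- **STRICTNESS FOR RETRACTS OF THE 2-SUBDIVISION.**  If `G₂ = subdiv G` is a retract of `F` (`ρ ∘ ι = id` for
homomorphisms `ι : G₂ → F`, `ρ : F → G₂`) and `e` is an edge of `G`, then `hom(F, CFI(G,{e})) < hom(F, CFI(G,∅))`:
the zero section over `ρ` is a homomorphism `F → CFI(G,∅)`; a lift of its shadow into `CFI(G,{e})` would restrict
along `ι` to a lift of the identity of `G₂`, which Chen–Flum–Liu's parity argument excludes.  `F = G₂`, `ι = ρ = id`
is their Thm 12.2. [cite: ChenFlumLiu2025, Thm 12.2 and Example 12.4] -/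
theorem card_hom_cfiGraph_lt_of_retract [Finite W] {e : Sym2 (Fin v)}
    [DecidablePred (· ∈ ({e} : Set (Sym2 (Fin v))))] (he : e ∈ G.edgeSet)
    (ι : subdiv G →g F) (ρ : F →g subdiv G) (hρι : ∀ x, ρ (ι x) = x) :
    Nat.card (F →g cfiGraph G ({e} : Set (Sym2 (Fin v)))) < Nat.card (F →g cfiEven G) := by
  classical
  rw [Dvorak2010.card_hom_eq_card_subtype, Dvorak2010.card_hom_eq_card_subtype]
  haveI := Fintype.ofFinite
    {g : W → CFIVertex G // Dvorak2010.IsHom F (cfiGraph G ({e} : Set (Sym2 (Fin v)))) g}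
  haveI := Fintype.ofFinite {g : W → CFIVertex G // Dvorak2010.IsHom F (cfiEven G) g}
  rw [Nat.card_eq_fintype_card, Nat.card_eq_fintype_card]
  obtain ⟨Φ, hΦ, hproj⟩ := exists_injective_projPreserving (G := G) F ({e} : Set (Sym2 (Fin v)))
  refine Fintype.card_lt_of_injective_not_surjective Φ hΦ fun hsurj => ?_
  -- the zero section over `ρ`
  have hzero : Dvorak2010.IsHom F (cfiEven G) (fun w => zeroLift (ρ w)) :=
    fun a b hab => isHom_zeroLift (ρ.map_rel hab)
  obtain ⟨f, hf⟩ := hsurj ⟨_, hzero⟩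
  refine not_isHom_of_proj_eq he (f := fun x => f.1 (ι x)) (fun a b hab => f.2 (ι.map_rel hab)) fun x => ?_
  have h1 := hproj f (ι x)
  have h2 : (Φ f).1 (ι x) = zeroLift (ρ (ι x)) := congrFun (congrArg Subtype.val hf) (ι x)
  rw [h2, proj_zeroLift, hρι] at h1
  exact h1.symm

/-! ### Transport and the assembled witnesses -/

/-- Homomorphism counts are invariant under isomorphisms of the host. [folklore] -/
theorem card_hom_congr_right {α β : Type*} {X : SimpleGraph α} {Y : SimpleGraph β} (e : X ≃g Y) :
    Nat.card (F →g X) = Nat.card (F →g Y) :=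
  Nat.card_congr
    { toFun := fun φ => e.toEmbedding.toHom.comp φ
      invFun := fun ψ => e.symm.toEmbedding.toHom.comp ψ
      left_inv := fun φ => by
        ext x
        exact e.symm_apply_apply (φ x)
      right_inv := fun ψ => by
        ext x
        exact e.apply_symm_apply (ψ x) }

/-- **UNCONDITIONAL WITNESSES FOR RETRACTS OF 2-SUBDIVIDED WIDE BASES.**  Let `G` be connected on `≥ 2` vertices with
`tw G ≥ k ≥ 1`, `e` an edge, and let `F` retract onto `G₂`.  Then the uncoloured CFI pair over `G` is `C^k`-equivalent
(Chen–Flum–Liu Thm 11.1, proved in the tree via Seymour–Thomas havens) and `hom(F, ·)` tells it apart.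
[cite: ChenFlumLiu2025, Thm 11.1, Thm 12.2] -/
theorem ckEquiv_and_card_hom_lt_of_retract [Finite W] {k : ℕ} (hconn : G.Connected) (h2 : 2 ≤ v)
    (hk : 1 ≤ k) (htw : k ≤ Literature.Combinatorics.SimpleGraph.treewidth G) {e : Sym2 (Fin v)} (he : e ∈ G.edgeSet)
    [DecidablePred (· ∈ ({e} : Set (Sym2 (Fin v))))]
    (ι : subdiv G →g F) (ρ : F →g subdiv G) (hρι : ∀ x, ρ (ι x) = x) :
    CkEquiv k (cfiEven G) (cfiGraph G ({e} : Set (Sym2 (Fin v)))) ∧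
      Nat.card (F →g cfiGraph G ({e} : Set (Sym2 (Fin v)))) < Nat.card (F →g cfiEven G) :=
  ⟨ChenFlumLiu2025_ckEquiv_of_le_treewidth_holds v k G hconn h2 hk htw e he,
    card_hom_cfiGraph_lt_of_retract F he ι ρ hρι⟩

/-- **The same witnesses on a standard vertex set `Fin m`, `m = |CFI(G)|`** (the format of (W1-simple) in
`SmallWitnessSimpleGraph`: hosts on `Fin m`, `C^k`-equivalent, different homomorphism counts).
[cite: ChenFlumLiu2025, Thm 11.1, Thm 12.2] -/
theorem exists_fin_witness_of_retract [Finite W] {k : ℕ} (hconn : G.Connected) (h2 : 2 ≤ v)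
    (hk : 1 ≤ k) (htw : k ≤ Literature.Combinatorics.SimpleGraph.treewidth G) (hE : G.edgeSet.Nonempty)
    (ι : subdiv G →g F) (ρ : F →g subdiv G) (hρι : ∀ x, ρ (ι x) = x) :
    ∃ (m : ℕ) (X Y : SimpleGraph (Fin m)), m = Fintype.card (CFIVertex G) ∧ CkEquiv k X Y ∧
      Nat.card (F →g Y) < Nat.card (F →g X) := by
  classical
  obtain ⟨e, he⟩ := hE
  obtain ⟨hck, hlt⟩ := ckEquiv_and_card_hom_lt_of_retract F hconn h2 hk htw he ι ρ hρι
  let φ := Fintype.equivFin (CFIVertex G)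
  refine ⟨Fintype.card (CFIVertex G), _, _, rfl,
    hck.iso_congr (SimpleGraph.Iso.map φ (cfiEven G))
      (SimpleGraph.Iso.map φ (cfiGraph G ({e} : Set (Sym2 (Fin v))))), ?_⟩
  rwa [← card_hom_congr_right F (SimpleGraph.Iso.map φ (cfiEven G)),
    ← card_hom_congr_right F (SimpleGraph.Iso.map φ (cfiGraph G ({e} : Set (Sym2 (Fin v)))))]


/-! ### Bases: transport to `Fin v`, and the grids -/

/-- **Transport of a base graph to a standard vertex set.**  A connected graph `H` on a finite type with `≥ 2` vertices
and `tw H ≥ k`, pushed forward along `Fintype.equivFin`, is a connected graph on `Fin |V|` with `≥ 2` vertices, tree-width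
`≥ k` and an edge — the hypotheses of `ckEquiv_and_card_hom_lt_of_retract`. [folklore; cite: Diestel2010, Lemma 12.3.1] -/
theorem base_transport {V : Type*} [Fintype V] (H : SimpleGraph V) (hconn : H.Connected)
    (h2 : 2 ≤ Fintype.card V) {k : ℕ} (hk : k ≤ Literature.Combinatorics.SimpleGraph.treewidth H) :
    (H.map (Fintype.equivFin V).toEmbedding).Connected ∧
      k ≤ Literature.Combinatorics.SimpleGraph.treewidth (H.map (Fintype.equivFin V).toEmbedding) ∧
      (H.map (Fintype.equivFin V).toEmbedding).edgeSet.Nonempty := by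
  classical
  have hconn' : (H.map (Fintype.equivFin V).toEmbedding).Connected :=
    (SimpleGraph.Iso.map (Fintype.equivFin V) H).connected_iff.1 hconn
  refine ⟨hconn', hk.trans ?_, ?_⟩
  · exact Literature.Combinatorics.SimpleGraph.treewidth_le_of_hom_injective
      (SimpleGraph.Iso.map (Fintype.equivFin V) H).toEmbedding.toHom
      (SimpleGraph.Iso.map (Fintype.equivFin V) H).injective
  · -- a connected graph on `≥ 2` vertices has an edge
    obtain ⟨a, b, hab⟩ : ∃ a b : Fin (Fintype.card V), a ≠ b := by
      refine ⟨⟨0, by omega⟩, ⟨1, by omega⟩, ?_⟩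
      simp [Fin.ext_iff]
    obtain ⟨p⟩ := hconn'.preconnected a b
    have hlen : 0 < p.length := by
      rcases Nat.eq_zero_or_pos p.length with h | h
      · exact absurd (SimpleGraph.Walk.eq_of_length_eq_zero h) hab
      · exact h
    exact ⟨s(p.getVert 0, p.getVert 1), (SimpleGraph.mem_edgeSet _).2 (p.adj_getVert_succ hlen)⟩

/-- **The grids are admissible bases**: the `(k+1) × (k+1)` grid (tree `grid k k`, the box product of two paths) is
connected, has `(k+1)² ≥ 2` vertices for `k ≥ 1`, and tree-width `≥ k` (tree `min_le_treewidth_grid`, the bramble of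
crosses); its maximum degree is `≤ 4`, so `card_cfiVertex_le` makes the CFI hosts over it of size `O(k²)`.
[cite: BondyMurty2008, §10.5; GalesiEtAl2023, §2] -/
theorem grid_base {k : ℕ} (hk : 1 ≤ k) :
    (Literature.Combinatorics.SimpleGraph.grid k k).Connected ∧
      2 ≤ Fintype.card (Fin (k + 1) × Fin (k + 1)) ∧
      k ≤ Literature.Combinatorics.SimpleGraph.treewidth (Literature.Combinatorics.SimpleGraph.grid k k) := by
  refine ⟨(SimpleGraph.pathGraph_connected k).boxProd (SimpleGraph.pathGraph_connected k), ?_, ?_⟩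
  · rw [Fintype.card_prod, Fintype.card_fin]
    nlinarith
  · simpa using Literature.Combinatorics.SimpleGraph.min_le_treewidth_grid k k

/-- **UNCONDITIONAL `O(k²)`-VERTEX WITNESSES OVER THE GRID.**  For `k ≥ 1` let `G_k` be the `(k+1) × (k+1)` grid on the
standard vertex set `Fin ((k+1)²)` (pushed forward along `Fintype.equivFin`).  Every finite graph `F` that retracts onto the
2-subdivision `(G_k)₂` is distinguished by two `C^k`-EQUIVALENT hosts on `m = |CFI(G_k)|` vertices. [cite: ChenFlumLiu2025, Thm 11.1, Thm 12.2; BondyMurty2008, §10.5] -/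
theorem exists_fin_witness_of_gridRetract [Finite W] {k : ℕ} (hk : 1 ≤ k)
    (ι : subdiv ((Literature.Combinatorics.SimpleGraph.grid k k).map
        (Fintype.equivFin (Fin (k + 1) × Fin (k + 1))).toEmbedding) →g F)
    (ρ : F →g subdiv ((Literature.Combinatorics.SimpleGraph.grid k k).map
        (Fintype.equivFin (Fin (k + 1) × Fin (k + 1))).toEmbedding))
    (hρι : ∀ x, ρ (ι x) = x) :
    ∃ (m : ℕ) (X Y : SimpleGraph (Fin m)),
      m = Fintype.card (CFIVertex ((Literature.Combinatorics.SimpleGraph.grid k k).map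
        (Fintype.equivFin (Fin (k + 1) × Fin (k + 1))).toEmbedding)) ∧
      CkEquiv k X Y ∧ Nat.card (F →g Y) < Nat.card (F →g X) := by
  classical
  obtain ⟨hconn, h2, htw⟩ := grid_base hk
  obtain ⟨hconn', htw', hE⟩ := base_transport (Literature.Combinatorics.SimpleGraph.grid k k) hconn h2 htw
  have h2' : 2 ≤ Fintype.card (Fin (k + 1) × Fin (k + 1)) := h2
  exact exists_fin_witness_of_retract F hconn' h2' hk htw' hE ι ρ hρι

/-! ### The size of the CFI graphs: linear for bases of bounded degree -/

/-- **`|CFI(G)| ≤ v · 2^Δ + 2 · v · Δ`** for a base graph on `Fin v` of maximum degree `Δ`: at most `2^{deg u}` gadget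
vertices over `u` (even subsets of the neighbourhood) and two end vertices per dart. [cite: CaiFurerImmerman1992, §6] -/
theorem card_cfiVertex_le :
    Fintype.card (CFIVertex G) ≤ v * 2 ^ G.maxDegree + 2 * (v * G.maxDegree) := by
  classical
  have hcard : Fintype.card (CFIVertex G) =
      Fintype.card ((Σ u : Fin v, {S : Finset (Fin v) // S ⊆ G.neighborFinset u ∧ Even S.card}) ⊕
        ({p : Fin v × Fin v // G.Adj p.1 p.2} × Bool)) :=
    Fintype.card_congr (Equiv.refl _)
  rw [hcard, Fintype.card_sum, Fintype.card_sigma, Fintype.card_prod, Fintype.card_bool]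
  have h1 : ∑ u : Fin v, Fintype.card {S : Finset (Fin v) // S ⊆ G.neighborFinset u ∧ Even S.card} ≤
      v * 2 ^ G.maxDegree := by
    calc ∑ u : Fin v, Fintype.card {S : Finset (Fin v) // S ⊆ G.neighborFinset u ∧ Even S.card}
        ≤ ∑ _u : Fin v, 2 ^ G.maxDegree := Finset.sum_le_sum fun u _ => ?_
      _ = v * 2 ^ G.maxDegree := by simp
    rw [Fintype.card_subtype]
    calc (Finset.univ.filter fun S : Finset (Fin v) => S ⊆ G.neighborFinset u ∧ Even S.card).card
        ≤ (G.neighborFinset u).powerset.card :=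
          Finset.card_le_card fun S hS => Finset.mem_powerset.2 (Finset.mem_filter.1 hS).2.1
      _ = 2 ^ G.degree u := by rw [Finset.card_powerset, SimpleGraph.card_neighborFinset_eq_degree]
      _ ≤ 2 ^ G.maxDegree := Nat.pow_le_pow_right (by norm_num) (G.degree_le_maxDegree u)
  have h2 : Fintype.card {p : Fin v × Fin v // G.Adj p.1 p.2} ≤ v * G.maxDegree := by
    have hd : Fintype.card {p : Fin v × Fin v // G.Adj p.1 p.2} = Fintype.card G.Dart :=
      Fintype.card_congr
        { toFun := fun p => ⟨p.1, p.2⟩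
          invFun := fun d => ⟨d.toProd, d.adj⟩
          left_inv := fun p => rfl
          right_inv := fun d => rfl }
    rw [hd, SimpleGraph.dart_card_eq_sum_degrees]
    calc ∑ u, G.degree u ≤ ∑ _u : Fin v, G.maxDegree := Finset.sum_le_sum fun u _ => G.degree_le_maxDegree u
      _ = v * G.maxDegree := by simp
  calc ∑ u : Fin v, Fintype.card {S : Finset (Fin v) // S ⊆ G.neighborFinset u ∧ Even S.card} +
        Fintype.card {p : Fin v × Fin v // G.Adj p.1 p.2} * 2
      ≤ v * 2 ^ G.maxDegree + v * G.maxDegree * 2 := Nat.add_le_add h1 (Nat.mul_le_mul_right 2 h2)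
    _ = v * 2 ^ G.maxDegree + 2 * (v * G.maxDegree) := by ring

end Summit.ValiantsHypothesis.ValiantsHypothesis.Theorems.CFIHomMonotone

end
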